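import Mathlib
import Summits.MatrixMultiplication.MatrixMultiplication.Theorems.AutomaticSTPPDesignsNontrivialAllScalesFamily
import Literature.Combinatorics.Additive.TripleProductProperty
import Literature.Computability.AlgebraicComplexity.PrattTrapezoidVal
import Literature.Computability.AlgebraicComplexity.PrattTrapezoidValSTPP
import Literature.Computability.AlgebraicComplexity.GroupTheoreticMatMulThmBProofs
import Literature.Computability.AutomaticStructures.AutomaticBlock

/-!
# Pratt's `Val(ℤ/nℤ)` grows polynomially faster than `n` — Conjecture 4.1 of Pratt 2024 fails

Route `MatrixMultiplication/AutomaticSTPPDesigns`, crux `stmt-MatrixMultiplication-7356`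
(`AutomaticPackingThesis`), line `Sketch`; support file (`--supports`). The crux's recorded
why-it-might-fail ends "Pratt2024 Conj 4.1 would bar `ℤ_n` hosts": by Pratt's Theorem 4.4
(tree: the named fact `Literature.Computability.AlgebraicComplexity.pratt2024_thm44`) packing-tight
STPP designs in prime-power cyclic groups force `Val(ℤ/nℤ) ≥ K n^{1+c}`, which his Conjecture 4.1
("for all `ε > 0`, `Val(ℤ_n) ≤ O(n^{1+ε})`", arXiv:2309.03878, Conj. 4.1 — "our weakest conjecture")
forbids. This file proves that the conclusion of Theorem 4.4 holds UNCONDITIONALLY: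

  `prattVal_superlinear : ∃ c > 0, ∃ K > 0, ∀ n ≥ 1, K · n^{1+c} ≤ Val(ℤ/nℤ)`,

so Conjecture 4.1 is false (`prattVal_not_subpolynomial`, also at prime moduli:
`prattVal_prime_not_subpolynomial`), the implication `pratt2024_thm44` (proved as printed in
`Literature/…/PrattPackingTransferThm44Proofs.lean`) has a conclusion that is true outright, and no
`Val`-type obstruction protects cyclic hosts — the barrier named in the crux is void (it neither
proves nor refutes the crux).

## The argument (all ingredients were already in the tree)

* A finite STPP design in a CYCLIC group beating its host in mass: the CKSU 2005 §5 two-triple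
  design in `ℤ/4 × ℤ/5 × ℤ/7 ≅ ℤ/140` (Chinese remainder), mass `144 > 140`, as digit sets
  `(D^A_i, D^B_i, D^C_i)_{i<2}` in `Fin 140`
  (`NontrivialAllScalesFamily.exists_digitDesign`, landed for route item stmt-7362).
* **Lossless powers inside one cyclic tower** (`addSimultaneousTPP_digitBox`, `sum_card_digitBox`):
  the digit boxes `∏_j D^A_{w_j}` read in base `140` form an STPP family in `ℤ/140^k` of mass
  EXACTLY `m^k`, `m ≥ 141` — the carry induction `NontrivialAllScalesFamily.digits_eq_of_pow_dvd`
  (the STPP of the digit design forces the lowest digits to agree, so they cancel exactly and no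
  carry is ever created). This is the step absent from the printed proof of Thm. 4.4, whose generic
  Freiman embedding `ℤ_q^N ↪ ℤ_{(3q)^N}` pays a factor `3` per coordinate and therefore needs
  `ω = 2`-strength designs to retain a polynomial gain; for designs living natively in a cyclic
  group no factor is paid, so ANY cyclic design with mass ratio `> 1` already gives `n^{1+c}`.
* Pratt's Prop. 3.3 (tree theorem `sum_card_mul_le_prattVal_of_addSimultaneousTPP`): the mass of an
  STPP family is a lower bound for `Val`; hence `Val(ℤ/140^k) ≥ 141^k = (140^k)^{1+c}`,
  `c = log 141 / log 140 - 1 > 0`.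
* All moduli (`sum_card_le_prattVal_of_three_mul_le`): an STPP family in `ℤ/M` maps into `ℤ/N` for
  every `N ≥ 3M` along `ZMod.val` (three-fold sums stay below `N`, so the map reflects them; tree
  lemma `sum_card_mul_le_prattVal_zmod_of_reflect`), and `|G| ≤ Val(G)` (`card_le_prattVal`)
  covers small `n`; with `140^k ≤ n/3 < 140^(k+1)` this gives `Val(ℤ/nℤ) ≥ (n/840)^{1+c}`.

## References

* K. Pratt, *On generalized corners and matrix multiplication*, ITCS 2024, arXiv:2309.03878:
  Def. 3.2 (`Val`), Prop. 3.3, Prop. 3.4, Conj. 4.1, Thm. 4.4 (and its proof, p. 9).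
* H. Cohn, R. Kleinberg, B. Szegedy, C. Umans, *Group-theoretic algorithms for matrix
  multiplication*, FOCS 2005, arXiv:math/0511460, §5 (the two-triple STPP example), Lemma 5.4.
-/

-- single-conjunct summit: the mandated namespace repeats `MatrixMultiplication`.
set_option linter.dupNamespace false

noncomputable section

namespace Summit.MatrixMultiplication.MatrixMultiplication.Theorems

namespace AutomaticPackingThesis

open Finset Literature.Combinatorics.Additive Literature.Computability.AlgebraicComplexity
  Literature.Computability.AutomaticStructures NontrivialAllScalesFamily

/-! ### Digit boxes: lossless powers of a digit design inside one cyclic tower -/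

/-- **Digit boxes over an STPP digit design are STPP at every scale.** If digit sets
`(D^A_i, D^B_i, D^C_i)_{i ∈ ι}` in `Fin p` form an STPP family in `ℤ/p`, then for every `k` the
boxes `∏_j D^A_{w_j}`, `∏_j D^B_{w_j}`, `∏_j D^C_{w_j}` (`w ∈ ι^k`), read in base `p` inside
`ℤ/(p^k)`, form an STPP family (carry induction `digits_eq_of_pow_dvd`: no carry is ever created).
[folklore] -/
theorem addSimultaneousTPP_digitBox {ι : Type*} {p : ℕ} [NeZero p] (DA DB DC : ι → Finset (Fin p))
    (hD : AddSimultaneousTPP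
      (fun i => (DA i).image fun d : Fin p => ((d : ℕ) : ZMod p))
      (fun i => (DB i).image fun d : Fin p => ((d : ℕ) : ZMod p))
      (fun i => (DC i).image fun d : Fin p => ((d : ℕ) : ZMod p)))
    (k : ℕ) :
    AddSimultaneousTPP
      (fun w : Fin k → ι => (Fintype.piFinset fun j => DA (w j)).image
        fun a : Fin k → Fin p => (digitValue a : ZMod (p ^ k)))
      (fun w : Fin k → ι => (Fintype.piFinset fun j => DB (w j)).image
        fun a : Fin k → Fin p => (digitValue a : ZMod (p ^ k)))
      (fun w : Fin k → ι => (Fintype.piFinset fun j => DC (w j)).image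
        fun a : Fin k → Fin p => (digitValue a : ZMod (p ^ k))) := by
  haveI : NeZero (p ^ k) := ⟨pow_ne_zero _ (NeZero.ne p)⟩
  rw [addSimultaneousTPP_iff_forall]
  intro I J K s hs s' hs' t ht t' ht' u hu u' hu' h0
  simp only [mem_image, Fintype.mem_piFinset] at hs hs' ht ht' hu hu'
  obtain ⟨S, hS, rfl⟩ := hs
  obtain ⟨S', hS', rfl⟩ := hs'
  obtain ⟨T, hT, rfl⟩ := ht
  obtain ⟨T', hT', rfl⟩ := ht'
  obtain ⟨U, hU, rfl⟩ := hu
  obtain ⟨U', hU', rfl⟩ := hu'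
  rw [stppSum_eq_intCast, ZMod.intCast_zmod_eq_zero_iff_dvd, Nat.cast_pow] at h0
  obtain ⟨hIJ, hJK, hSS, hTT, hUU⟩ :=
    digits_eq_of_pow_dvd DA DB DC hD k I J K S S' T T' U U' hS hS' hT hT' hU hU' h0
  exact ⟨hIJ, hJK, by rw [hSS], by rw [hTT], by rw [hUU]⟩

/-- **The mass of the digit-box family is multiplicative**: at scale `k` it is the `k`-th power of
the mass of the digit design (the base-`p` value map is injective on digit words, box sizes are
products, and `(∑ᵢ xᵢ)^k = ∑_{w ∈ ι^k} ∏_j x_{w_j}`). [folklore] -/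
theorem sum_card_digitBox {ι : Type*} [Fintype ι] [DecidableEq ι] {p : ℕ}
    (DA DB DC : ι → Finset (Fin p)) (k : ℕ) :
    ∑ w : Fin k → ι,
      #((Fintype.piFinset fun j => DA (w j)).image
          fun a : Fin k → Fin p => (digitValue a : ZMod (p ^ k))) *
        #((Fintype.piFinset fun j => DB (w j)).image
          fun a : Fin k → Fin p => (digitValue a : ZMod (p ^ k))) *
        #((Fintype.piFinset fun j => DC (w j)).image
          fun a : Fin k → Fin p => (digitValue a : ZMod (p ^ k))) =
      (∑ i, #(DA i) * #(DB i) * #(DC i)) ^ k := by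
  simp only [card_image_of_injective _ (natCast_digitValue_injective p k), Fintype.card_piFinset,
    ← prod_mul_distrib]
  rw [Finset.sum_pow', Fintype.piFinset_univ]

/-! ### Transfer to every modulus -/

/-- **STPP families move up to every modulus `N ≥ 3M`.** An STPP family in `ℤ/M` is carried into
`ℤ/N` by `x ↦ x.val` for every `N ≥ 3M`: three-fold sums of representatives stay below `N`, so the
map reflects three-fold sums (tree lemma `sum_card_mul_le_prattVal_zmod_of_reflect`, the transport
in the proofs of Pratt's Thms. 4.4/4.7), and Prop. 3.3 bounds `Val(ℤ/N)` below by the mass.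
[cite: Pratt2024, Prop. 4.3 (3) and Thm. 4.4 (proof)] -/
theorem sum_card_le_prattVal_of_three_mul_le {M : ℕ} [NeZero M] {ι : Type*} [Fintype ι]
    {A B C : ι → Finset (ZMod M)} (hS : AddSimultaneousTPP A B C) {N : ℕ} [NeZero N]
    (hN : 3 * M ≤ N) : ∑ i, #(A i) * #(B i) * #(C i) ≤ prattVal (ZMod N) := by
  refine sum_card_mul_le_prattVal_zmod_of_reflect hS (ψ := fun x : ZMod M => x.val) ?_ ?_
  · intro a b c
    have ha := ZMod.val_lt a
    have hb := ZMod.val_lt b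
    have hc := ZMod.val_lt c
    omega
  · intro a b c a' b' c' h
    have h' := congrArg (fun n : ℕ => (n : ZMod M)) h
    simpa only [Nat.cast_add, ZMod.natCast_val, ZMod.cast_id', id_eq] using h'

/-! ### The growth of `Val(ℤ/nℤ)` -/

/-- **A cyclic `140`-tower of STPP designs with polynomially super-packed mass**: for every `k` there
is an STPP family in `ℤ/140^k` of mass `m^k` for a fixed `m ≥ 141` (the CKSU two-triple design in
`ℤ/140`, digit boxes at scale `k`). [cite: CohnKleinbergSzegedyUmans2005, §5] -/
theorem exists_design_pow : ∃ m : ℕ, 140 < m ∧ ∀ k : ℕ,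
    ∃ (n : ℕ) (A B C : Fin n → Finset (ZMod (140 ^ k))),
      AddSimultaneousTPP A B C ∧ ∑ i, #(A i) * #(B i) * #(C i) = m ^ k := by
  classical
  obtain ⟨DA, DB, DC, hD, hmass⟩ := exists_digitDesign
  haveI : NeZero (140 : ℕ) := ⟨by norm_num⟩
  refine ⟨∑ i, #(DA i) * #(DB i) * #(DC i), hmass, fun k => ?_⟩
  -- the digit-box family at scale `k`, reindexed along `Fin n ≃ (Fin k → Fin 2)`
  set e : Fin (Fintype.card (Fin k → Fin 2)) ≃ (Fin k → Fin 2) :=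
    (Fintype.equivFin (Fin k → Fin 2)).symm with he
  have hS := (addSimultaneousTPP_digitBox DA DB DC hD k).comp e.injective
  refine ⟨Fintype.card (Fin k → Fin 2), _, _, _, hS, ?_⟩
  rw [← sum_card_digitBox DA DB DC k]
  exact e.sum_comp (fun w : Fin k → Fin 2 =>
    #((Fintype.piFinset fun j => DA (w j)).image
        fun a : Fin k → Fin 140 => (digitValue a : ZMod (140 ^ k))) *
      #((Fintype.piFinset fun j => DB (w j)).image
        fun a : Fin k → Fin 140 => (digitValue a : ZMod (140 ^ k))) *
      #((Fintype.piFinset fun j => DC (w j)).image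
        fun a : Fin k → Fin 140 => (digitValue a : ZMod (140 ^ k))))

/-- **`Val` along the `140`-tower**: `m^k ≤ Val(ℤ/N)` for every `N ≥ 3·140^k`, with the fixed
`m ≥ 141` of `exists_design_pow`. [folklore] -/
theorem exists_pow_le_prattVal : ∃ m : ℕ, 140 < m ∧ ∀ (k N : ℕ) [NeZero N],
    3 * 140 ^ k ≤ N → m ^ k ≤ prattVal (ZMod N) := by
  obtain ⟨m, hm, h⟩ := exists_design_pow
  refine ⟨m, hm, fun k N _ hN => ?_⟩
  obtain ⟨n, A, B, C, hS, hsum⟩ := h k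
  haveI : NeZero (140 ^ k) := ⟨pow_ne_zero _ (by norm_num)⟩
  rw [← hsum]
  exact sum_card_le_prattVal_of_three_mul_le hS hN

/-- **`Val(ℤ/nℤ) ≥ K n^{1+c}` for all `n`** — the conclusion of Pratt's Theorem 4.4, unconditionally;
equivalently, Pratt's Conjecture 4.1 is false. With `m ≥ 141` from `exists_design_pow`:
`c = log m / log 140 - 1 > 0`, `K = 840^{-(1+c)}`; for `n ≥ 420` choose `k` with
`140^k ≤ n/3 < 140^(k+1)`, so `Val(ℤ/nℤ) ≥ m^k = (140^k)^{1+c} ≥ (n/840)^{1+c}`; for `n < 420`,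
`Val(ℤ/nℤ) ≥ n ≥ n/840 ≥ (n/840)^{1+c}`. [folklore] -/
theorem prattVal_superlinear : ∃ c : ℝ, 0 < c ∧ ∃ K : ℝ, 0 < K ∧ ∀ (n : ℕ) (_ : NeZero n),
    K * (n : ℝ) ^ (1 + c) ≤ (prattVal (ZMod n) : ℝ) := by
  obtain ⟨m, hm, hval⟩ := exists_pow_le_prattVal
  have h140 : (1 : ℝ) < 140 := by norm_num
  have hlog140 : 0 < Real.log 140 := Real.log_pos h140
  have hmR : (140 : ℝ) < m := by exact_mod_cast hm
  have hlogm : Real.log 140 < Real.log m := Real.log_lt_log (by norm_num) hmR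
  set c : ℝ := Real.log m / Real.log 140 - 1 with hc
  have hcpos : 0 < c := by
    rw [hc, sub_pos, lt_div_iff₀ hlog140, one_mul]
    exact hlogm
  have h1c : 0 < 1 + c := by linarith
  -- `140^(1+c) = m`, hence `(140^k)^(1+c) = m^k`
  have hpow : ∀ k : ℕ, (((140 : ℕ) ^ k : ℕ) : ℝ) ^ (1 + c) = ((m ^ k : ℕ) : ℝ) := by
    intro k
    have h140m : (140 : ℝ) ^ (1 + c) = m := by
      rw [Real.rpow_def_of_pos (by norm_num : (0 : ℝ) < 140)]
      have : Real.log 140 * (1 + c) = Real.log m := by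
        rw [hc]; field_simp; ring
      rw [this, Real.exp_log (by linarith)]
    push_cast
    rw [← Real.rpow_natCast, ← Real.rpow_mul (by norm_num : (0 : ℝ) ≤ 140), mul_comm,
      Real.rpow_mul (by norm_num : (0 : ℝ) ≤ 140), h140m, Real.rpow_natCast]
  refine ⟨c, hcpos, (1 / 840 : ℝ) ^ (1 + c), Real.rpow_pos_of_pos (by norm_num) _, ?_⟩
  intro n hn
  have hn1 : 1 ≤ n := Nat.one_le_iff_ne_zero.2 (NeZero.ne n)
  have hnR : (1 : ℝ) ≤ n := by exact_mod_cast hn1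
  -- `K n^(1+c) = (n/840)^(1+c)`
  have hK : (1 / 840 : ℝ) ^ (1 + c) * (n : ℝ) ^ (1 + c) = ((n : ℝ) / 840) ^ (1 + c) := by
    rw [← Real.mul_rpow (by norm_num) (by positivity)]
    congr 1
    ring
  rw [hK]
  by_cases hsmall : n < 420
  · -- small moduli: `Val ≥ |G| = n ≥ n/840 ≥ (n/840)^(1+c)`
    have hle1 : (n : ℝ) / 840 ≤ 1 := by
      rw [div_le_one (by norm_num)]
      exact_mod_cast (by omega : n ≤ 840)
    have hpos : 0 < (n : ℝ) / 840 := by positivity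
    calc ((n : ℝ) / 840) ^ (1 + c) ≤ ((n : ℝ) / 840) ^ (1 : ℝ) :=
          Real.rpow_le_rpow_of_exponent_ge hpos hle1 (by linarith)
      _ = (n : ℝ) / 840 := Real.rpow_one _
      _ ≤ n := by
          rw [div_le_iff₀ (by norm_num)]
          nlinarith
      _ = (Fintype.card (ZMod n) : ℝ) := by rw [ZMod.card]
      _ ≤ (prattVal (ZMod n) : ℝ) := by exact_mod_cast card_le_prattVal
  · -- large moduli: `140^k ≤ n/3 < 140^(k+1)`
    push Not at hsmall
    set k : ℕ := Nat.log 140 (n / 3) with hk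
    have hn3 : n / 3 ≠ 0 := by omega
    have hlow : 140 ^ k ≤ n / 3 := Nat.pow_log_le_self 140 hn3
    have hup : n / 3 < 140 ^ (k + 1) := Nat.lt_pow_succ_log_self (by norm_num) _
    have h3 : 3 * 140 ^ k ≤ n := by omega
    have hval' := hval k n h3
    -- `n/840 ≤ 140^k`
    have hn840 : (n : ℝ) / 840 ≤ (((140 : ℕ) ^ k : ℕ) : ℝ) := by
      rw [div_le_iff₀ (by norm_num)]
      have : n ≤ 140 ^ k * 840 := by
        have : n < 3 * 140 ^ (k + 1) + 3 := by omega
        rw [pow_succ] at this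
        omega
      exact_mod_cast this
    calc ((n : ℝ) / 840) ^ (1 + c) ≤ (((140 : ℕ) ^ k : ℕ) : ℝ) ^ (1 + c) :=
          Real.rpow_le_rpow (by positivity) hn840 h1c.le
      _ = ((m ^ k : ℕ) : ℝ) := hpow k
      _ ≤ (prattVal (ZMod n) : ℝ) := by exact_mod_cast hval'

/-- **Pratt's Conjecture 4.1 is false**: it is not the case that `Val(ℤ/nℤ) ≤ K_ε n^{1+ε}` for
every `ε > 0` (take `ε = c/2` in `prattVal_superlinear` and let `n → ∞`).
[cite: Pratt2024, Conj. 4.1] -/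
theorem prattVal_not_subpolynomial :
    ¬ ∀ ε : ℝ, 0 < ε → ∃ K : ℝ, ∀ (n : ℕ) (_ : NeZero n),
      (prattVal (ZMod n) : ℝ) ≤ K * (n : ℝ) ^ (1 + ε) := by
  intro h
  obtain ⟨c, hc, K, hK, hlow⟩ := prattVal_superlinear
  obtain ⟨K', hup⟩ := h (c / 2) (by positivity)
  -- `K n^(1+c) ≤ K' n^(1+c/2)` for all `n`, i.e. `K n^(c/2) ≤ K'`: impossible as `n → ∞`
  have hK' : 0 < K' := by
    have h1 := (hlow 1 inferInstance).trans (hup 1 inferInstance)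
    simp only [Nat.cast_one, Real.one_rpow, mul_one] at h1
    linarith
  -- choose `n` with `n^(c/2) > K'/K`
  obtain ⟨n, hn⟩ := exists_nat_gt ((K' / K) ^ (2 / c))
  have hn0 : 0 < n := by
    have : (0 : ℝ) < n := lt_of_le_of_lt (by positivity) hn
    exact_mod_cast this
  haveI : NeZero n := ⟨hn0.ne'⟩
  have key := (hlow n inferInstance).trans (hup n inferInstance)
  -- rewrite `n^(1+c) = n^(1+c/2) * n^(c/2)`
  have hsplit : (n : ℝ) ^ (1 + c) = (n : ℝ) ^ (1 + c / 2) * (n : ℝ) ^ (c / 2) := by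
    rw [← Real.rpow_add (by exact_mod_cast hn0)]
    congr 1
    ring
  rw [hsplit, ← mul_assoc] at key
  have hpos : 0 < (n : ℝ) ^ (1 + c / 2) := by positivity
  have key' : K * (n : ℝ) ^ (c / 2) ≤ K' := by
    have := key
    nlinarith [mul_comm K ((n : ℝ) ^ (1 + c / 2))]
  -- but `n^(c/2) > K'/K`
  have hgt : K' / K < (n : ℝ) ^ (c / 2) := by
    have h2c : 0 < 2 / c := by positivity
    have hbase : 0 ≤ K' / K := by positivity
    calc K' / K = ((K' / K) ^ (2 / c)) ^ (c / 2) := by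
          rw [← Real.rpow_mul hbase]
          have : 2 / c * (c / 2) = 1 := by field_simp
          rw [this, Real.rpow_one]
      _ < (n : ℝ) ^ (c / 2) := Real.rpow_lt_rpow (by positivity) hn (by positivity)
  rw [div_lt_iff₀ hK] at hgt
  linarith [mul_comm K ((n : ℝ) ^ (c / 2))]

/-- **Conjecture 4.1 fails already at prime moduli** (the form used by the transfers of Pratt's §4,
cf. the proof of Cor. 4.5: Bertrand's postulate supplies a prime in `[n, 2n]`, and `Val(ℤ/Pℤ)`
inherits the lower bound at `P`): there are `c > 0` and `K > 0` with `K P^{1+c} ≤ Val(ℤ/Pℤ)` for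
every prime `P`, and in particular `Val(ℤ/Pℤ) ≤ K_ε P^{1+ε}` fails for `ε < c` along the primes.
[folklore] -/
theorem prattVal_prime_not_subpolynomial :
    ¬ ∀ ε : ℝ, 0 < ε → ∃ K : ℝ, ∀ (p : ℕ) [Fact p.Prime],
      (prattVal (ZMod p) : ℝ) ≤ K * (p : ℝ) ^ (1 + ε) := by
  intro h
  obtain ⟨c, hc, K, hK, hlow⟩ := prattVal_superlinear
  obtain ⟨K₀, hup₀⟩ := h (c / 2) (by positivity)
  -- enlarge the constant to a positive one
  set K' : ℝ := max K₀ 1 with hK'def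
  have hK' : 0 < K' := lt_of_lt_of_le one_pos (le_max_right _ _)
  have hup : ∀ (p : ℕ) [Fact p.Prime], (prattVal (ZMod p) : ℝ) ≤ K' * (p : ℝ) ^ (1 + c / 2) := by
    intro p _
    refine (hup₀ p).trans ?_
    exact mul_le_mul_of_nonneg_right (le_max_left _ _) (by positivity)
  -- a prime `P` with `P^(c/2) > K'/K` (there are primes above any bound)
  obtain ⟨n, hn⟩ := exists_nat_gt ((K' / K) ^ (2 / c))
  obtain ⟨P, hnP, hP⟩ := Nat.exists_infinite_primes (n + 1)
  haveI : Fact P.Prime := ⟨hP⟩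
  have hPpos : (0 : ℝ) < P := by exact_mod_cast hP.pos
  have hnP' : ((K' / K) ^ (2 / c) : ℝ) < P := hn.trans (by exact_mod_cast hnP)
  have key := (hlow P inferInstance).trans (hup P)
  have hsplit : (P : ℝ) ^ (1 + c) = (P : ℝ) ^ (1 + c / 2) * (P : ℝ) ^ (c / 2) := by
    rw [← Real.rpow_add hPpos]
    congr 1
    ring
  rw [hsplit, ← mul_assoc] at key
  have hpos : 0 < (P : ℝ) ^ (1 + c / 2) := by positivity
  have key' : K * (P : ℝ) ^ (c / 2) ≤ K' := by
    nlinarith [mul_comm K ((P : ℝ) ^ (1 + c / 2))]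
  have hgt : K' / K < (P : ℝ) ^ (c / 2) := by
    have hbase : 0 ≤ K' / K := by positivity
    calc K' / K = ((K' / K) ^ (2 / c)) ^ (c / 2) := by
          rw [← Real.rpow_mul hbase]
          have : 2 / c * (c / 2) = 1 := by field_simp
          rw [this, Real.rpow_one]
      _ < (P : ℝ) ^ (c / 2) := Real.rpow_lt_rpow (by positivity) hnP' (by positivity)
  rw [div_lt_iff₀ hK] at hgt
  linarith [mul_comm K ((P : ℝ) ^ (c / 2))]

/-- Registered stub `stub_prattValSuperlinear` of crux stmt-MatrixMultiplication-7356 (barrier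
analysis of line `Sketch`): the conclusion of Pratt's Theorem 4.4 holds unconditionally — verbatim
`prattVal_superlinear`. [folklore] -/
theorem stub_prattValSuperlinear : ∃ c : ℝ, 0 < c ∧ ∃ K : ℝ, 0 < K ∧ ∀ (n : ℕ) (_ : NeZero n),
    K * (n : ℝ) ^ (1 + c) ≤ (Literature.Computability.AlgebraicComplexity.prattVal (ZMod n) : ℝ) :=
  prattVal_superlinear

end AutomaticPackingThesis

end Summit.MatrixMultiplication.MatrixMultiplication.Theorems

end
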